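import Literature.Analysis.FluidPDE.ChenTsaiZhang2022LocalRegularity
import Literature.Analysis.FluidPDE.OzanskiPalasek2022AxisymWeakL3Quantitative
import HarnessLib

/-!
# SwirlHolderTower — the Ożański–Palasek double exponential is `exp ∘ (1/γ)`, `γ` = the swirl
# Hölder exponent at the axis; `γ` is exponentially small for PASSIVE swirls (the funnel), so the
# improvable exponent is NS-essential (ROUND-15, seat nsreg-p2)

**The tower, located.**  Ożański–Palasek (arXiv:2210.10030, Thm 1.1 / Cor 1.2) prove for
axisymmetric solutions with `‖u‖_{L^∞_t L^{3,∞}_x} ≤ A`: `‖∇^j u(t)‖_∞ ≤ t^{-(1+j)/2} exp exp A^{O(1)}`,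
hence the weak-`L³` blow-up rate `(log log (T-t)⁻¹)^c`.  Anatomy (p. 17 Steps 1–2, p. 18 Steps
3–4): STEP 1 is the Hölder estimate `|Θ| ≤ r^γ A^{O(1)}` for the swirl `Θ = r u_θ` near the axis
with `γ = exp(-A^{O(1)})` (their Prop. 5.1 = Nazarov–Uraltseva 2012 quantified:
`γ = exp(-𝒩^{O(1)})`, `𝒩` a critical Morrey gauge of the drift `b = u + 2e_r/r`); STEPS 2–4 are
an energy method for `(ω_r/r, ω_θ/r)` localised to `{r < r₀}` where `|Θ|` must be small, which
forces `r₀ = γ^{O(1)/γ} = exp(-exp A^{O(1)})`, and closes with `E(1) ≲ r₀^{-12}` (p. 18 L46–54: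
Grönwall with `τ = r₀⁴`).  So the final bound is POLYNOMIAL in `1/r₀` and `log(1/r₀) ≍ (1/γ)·log`:
the outer exponential is `1/γ`, the inner one is the form of `γ(A)`.  PURPOSE-LITERAL EXPONENT:
the profile `γ(A)`.  `γ(A) ≥ A^{-p}` (a POLYNOMIAL swirl Hölder law) ⇒ `r₀ = exp(-A^{p+o(1)})` ⇒
single-exponential Theorem 1.1 ⇒ weak-`L³` blow-up rate `(log (T-t)⁻¹)^{c}` — crossing from the
empty `(log log)^c` class to the log-corrected Type-I class (§2 below: `log_towerBound_of_poly`,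
`loglog_towerBound_of_exp`, `rate_of_singleExp`, `rate_of_doubleExp`).

**The inner exponential is a LINEAR invariant (new).**  For the PASSIVE swirl equation
`b·∇Θ + (2/r)∂_rΘ = ΔΘ` with a divergence-free axisymmetric drift of critical size
`|b(x)| ≤ N/|x|` the exponent `exp(-N^{O(1)})` cannot be improved to anything better than
`e^{-N/4}`: the explicit `-1`-homogeneous FUNNEL drift
`u_N(x) = N (2|x|⁴)⁻¹ (x₁(x₃²-x₁²-x₂²), x₂(x₃²-x₁²-x₂²), 2x₃³)` (equatorial inflow `N/2|x|`, polar
jets `N/|x|`, `div u_N = 0`, `|u_N| ≤ N/|x|`) carries the separable steady solutions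
`Θ_N(x) = |x|^γ φ(ϑ)` (`ϑ` the polar angle; below `G(cos ϑ) = φ(ϑ)`) where `φ` solves the angular ODE
`φ'' + (-cot ϑ + (N/2) sin ϑ cos ϑ) φ' + γ(γ - 1 - (N/2)(3cos²ϑ - 1)) φ = 0`, `φ(0) = φ(π) = 0`,
`φ > 0`, and the principal exponent is `γ(N) = √(N/π) e^{-N/4} (1 + O(1/N))`.  MEANING: a small
exponent is NON-DECAY — on the equatorial inflow sheet `Θ_N` keeps the fraction `ρ^{γ(N)}` of its
unit-scale value down to radius `ρ` although it vanishes on the axis through the origin; in the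
Feynman–Kac picture `γ(N)` is the Kramers rate (per unit of `log(1/ρ)`) at which backward paths,
held on the sheet by the reversed drift (well depth `N/4` of `U = ln sin ϑ - (N/4) sin²ϑ`), leak to
the absorbing axis (numerics kit job j269992: `γ(16) = 6.61e-2`,
`γ(32) = 1.28e-3`, `γ(64) = 5.47e-7`, `γ(96) = 2.19e-10`, ratio to `√(N/π)e^{-N/4}` = 1.60, 1.20,
1.08, 1.05).  Hence (`linearHolderLaw_ceiling`, kernel-checked from the two classical packages
`FunnelSeparation` (chain rule in spherical coordinates) and `FunnelExponent` (the ODE fact)):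
EVERY Hölder law valid for the linear class has profile `γ(N) ≤ 2√(N/π)e^{-N/4}`, in
particular no polynomial profile (`not_linearPolyHolderLaw`), while the print profile
`exp(-C N^θ)` is consistent.  Consequence: no argument that sees `u` only through (critical norm,
incompressibility, axisymmetry) can lower the Ożański–Palasek tower; a polynomial swirl Hölder law
for NAVIER–STOKES solutions (`PolyHolderLaw`, the typed rung, CTZ frame) must use the `u`–`Θ`
coupling — e.g. that a funnel of strength `N` sucks high-`Θ` fluid against the centrifugal force
`Θ²/r³` — and is exactly what separates `(log log)^c` from `(log)^c`.

§4 types the two GLOBAL thresholds verbatim against the tree's renderings of the printed facts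
(`OzanskiPalasekSingleExp` = Thm 1.1 with `exp(A^C)` for `exp exp(A^C)`; `WeakL3LogRate` = Cor 1.2
with `log` for `log log`) and checks each implies the printed one (`toPrinted`).

This file: §§1, 2, 4; the linear class, the funnel and the ceiling (§3) are in the sibling
`…Theorems.SwirlHolderTowerFunnel` (split for the 400-line rule).
Memo: `run/shared/lean/pub/ns-regularity-ideate/ns-regularity-ideate-p2/ROUND-15.md`.
-/

namespace Summit.NavierStokesRegularity.NavierStokesRegularity.Theorems.SwirlHolderTower

open MeasureTheory Set Filter Topology Metric WithLp
open scoped ENNReal NNReal Laplacian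
open Literature.Analysis Literature.Analysis.FluidPDE Literature.Analysis.FluidPDE.ChenTsaiZhang2022


noncomputable section

/-! ## 1. The Navier–Stokes-side object: a swirl Hölder law at the axis with profile `γ` -/

/-- **SWIRL HÖLDER LAW with profile `γ`** (Chen–Tsai–Zhang frame).  For every axisymmetric suitable
weak solution `(u, p)` in `Q(1)`, every axis point `z₀ ∈ Q(1/8)`, every `M ≥ 0` bounding the scaled
energy `A(z₀, R) = cknA R z₀ u ≤ M` at ALL scales `0 < R ≤ 1/4`: if the swirl `Γ = r u^θ` lies in
`[a, b]` a.e. on `Q(z₀, 1/4)`, then on `Q(z₀, r)` it lies a.e. in an interval of length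
`≤ K (1+M)^K (4r)^{γ(M)} (b - a)`.  Ożański–Palasek Prop. 5.1 / Chen–Tsai–Zhang Prop. 1.2 give it
with `γ(M) = exp(-C(1+M)^θ)` (`ExpHolderLaw`); the question of the round is the FORM of `γ`. -/
def SwirlHolderLaw (γ : ℝ → ℝ) : Prop :=
  ∃ K : ℝ, 0 < K ∧ ∀ (u : ℝ → (EuclideanSpace ℝ (Fin 3)) → (EuclideanSpace ℝ (Fin 3))) (p : ℝ → (EuclideanSpace ℝ (Fin 3)) → ℝ),
    IsSuitableWeakSolutionInBall 1 0 u p →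
    (∀ t ∈ Ioo (-1 : ℝ) 0, IsAxisymmetric (u t)) →
    (∀ t ∈ Ioo (-1 : ℝ) 0, IsAxisymmetricScalar (p t)) →
    ∀ z₀ ∈ parabolicCylinder (1 / 8) (0 : ℝ × (EuclideanSpace ℝ (Fin 3))), cylRadius z₀.2 = 0 →
    ∀ M : ℝ, 0 ≤ M → (∀ R : ℝ, 0 < R → R ≤ 1 / 4 → cknA R z₀ u ≤ ENNReal.ofReal M) →
    ∀ a b : ℝ, a ≤ b →
    (∀ᵐ z ∂(volume.restrict (parabolicCylinder (1 / 4) z₀)), swirl (u z.1) z.2 ∈ Icc a b) →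
    ∀ r : ℝ, 0 < r → r ≤ 1 / 4 →
    ∃ a' b' : ℝ, a' ≤ b' ∧
      (∀ᵐ z ∂(volume.restrict (parabolicCylinder r z₀)), swirl (u z.1) z.2 ∈ Icc a' b') ∧
      b' - a' ≤ K * (1 + M) ^ K * (4 * r) ^ (γ M) * (b - a)

/-- A law with a (pointwise on `M ≥ 0`) smaller nonnegative profile is a weaker statement. -/
theorem SwirlHolderLaw.anti {γ₁ γ₂ : ℝ → ℝ} (hle : ∀ M : ℝ, 0 ≤ M → γ₁ M ≤ γ₂ M)
    (h : SwirlHolderLaw γ₂) : SwirlHolderLaw γ₁ := by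
  obtain ⟨K, hK, hlaw⟩ := h
  refine ⟨K, hK, ?_⟩
  intro u p hsws haxi haxip z₀ hz₀ hax M hM hA a b hab hconf r hr hr4
  obtain ⟨a', b', ha'b', hconf', hdec⟩ :=
    hlaw u p hsws haxi haxip z₀ hz₀ hax M hM hA a b hab hconf r hr hr4
  refine ⟨a', b', ha'b', hconf', hdec.trans ?_⟩
  have h4r : 4 * r ≤ 1 := by linarith
  have hpow : (4 * r) ^ (γ₂ M) ≤ (4 * r) ^ (γ₁ M) :=
    Real.rpow_le_rpow_of_exponent_ge (by linarith) h4r (hle M hM)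
  have hKM : 0 ≤ K * (1 + M) ^ K := by positivity
  have := mul_le_mul_of_nonneg_left hpow hKM
  exact mul_le_mul_of_nonneg_right this (by linarith)

/-- **THE RUNG — POLYNOMIAL SWIRL HÖLDER LAW with exponent `p`.**  FALSE for passive swirls
(`not_linearPolyHolderLaw`: the funnel), OPEN for Navier–Stokes, and — by Ożański–Palasek §7
verbatim with `γ = A^{-p}` — worth exactly one exponential of their tower
(`log_towerBound_of_poly`): the statement separating the `(log log)^c` weak-`L³` rate from
`(log)^c`. Any proof must use the `u`–`Θ` coupling. -/
@[conjecture] def PolyHolderLaw (p : ℝ) : Prop :=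
  ∃ c : ℝ, 0 < c ∧ SwirlHolderLaw (fun M => c * (1 + M) ^ (-p))

/-- **EXPONENTIAL SWIRL HÖLDER LAW with exponent `θ`** — the shape in print (Ożański–Palasek
Prop. 5.1: `γ = exp(-𝒩^{O(1)})`; Chen–Tsai–Zhang Prop. 1.2's one-scale decrement
`¼exp(-C(1+A)^8)` iterates to it with `θ = 8`, ROUND-14 `ExpDecrementLaw 8`). -/
def ExpHolderLaw (θ : ℝ) : Prop :=
  ∃ C : ℝ, 0 < C ∧ SwirlHolderLaw (fun M => Real.exp (-(C * (1 + M) ^ θ)))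

/-- The polynomial laws are nested upward in the exponent. -/
theorem PolyHolderLaw.mono {p₁ p₂ : ℝ} (hp : p₁ ≤ p₂) (h : PolyHolderLaw p₁) : PolyHolderLaw p₂ := by
  obtain ⟨c, hc, hlaw⟩ := h
  refine ⟨c, hc, hlaw.anti ?_⟩
  intro M hM
  have h1 : (1 : ℝ) ≤ 1 + M := by linarith
  exact mul_le_mul_of_nonneg_left (Real.rpow_le_rpow_of_exponent_le h1 (by linarith)) hc.le

/-! ## 2. Tower calculus: the form of `γ` is the height of the tower (Ożański–Palasek §7) -/

/-- The smallness radius `r₀ = ε^{1/g}`: where a modulus `r^g` first drops below `ε`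
(OP22 p. 17: `|Θ| ≤ r^γ A^{O(1)}` must be `≤ A^{-O(1)}` on `{r < r₀}`). -/
def smallnessRadius (g ε : ℝ) : ℝ := ε ^ (1 / g)

/-- `log (1/r₀) = (1/g) log (1/ε)` for the smallness radius `r₀ = ε^{1/g}`. -/
theorem log_inv_smallnessRadius {g ε : ℝ} (hε : 0 < ε) :
    Real.log (smallnessRadius g ε)⁻¹ = Real.log ε⁻¹ / g := by
  unfold smallnessRadius
  rw [Real.log_inv, Real.log_inv, Real.log_rpow hε]
  ring

/-- OP22 bookkeeping (p. 18 L46–54, Grönwall with `τ = r₀⁴`): the final bound is `≲ r₀^{-12}`. -/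
def towerBound (g ε : ℝ) : ℝ := ((smallnessRadius g ε)⁻¹) ^ (12 : ℕ)

/-- `log` of the tower bound: `12 (1/g) log (1/ε)`. -/
theorem log_towerBound {g ε : ℝ} (hε : 0 < ε) :
    Real.log (towerBound g ε) = 12 * (Real.log ε⁻¹ / g) := by
  unfold towerBound
  rw [Real.log_pow, log_inv_smallnessRadius hε]
  norm_num

/-- **POLYNOMIAL profile ⇒ SINGLE-exponential tower**: with `γ ≥ c(1+A)^{-p}` and smallness target
`ε = (1+A)^{-q}`, `log E ≤ 12 q log(1+A) (1+A)^p / c`. -/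
theorem log_towerBound_of_poly {c p q A g : ℝ} (hc : 0 < c) (hq : 0 < q) (hA : 0 ≤ A)
    (hg : c * (1 + A) ^ (-p) ≤ g) :
    Real.log (towerBound g ((1 + A) ^ (-q))) ≤ 12 * q * Real.log (1 + A) * (1 + A) ^ p / c := by
  have h1A : 0 < 1 + A := by linarith
  have hε : 0 < (1 + A) ^ (-q) := Real.rpow_pos_of_pos h1A _
  have hgpos : 0 < g := lt_of_lt_of_le (by positivity) hg
  rw [log_towerBound hε, Real.log_inv, Real.log_rpow h1A]
  have hlog : 0 ≤ Real.log (1 + A) := Real.log_nonneg (by linarith)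
  have hnum : 0 ≤ q * Real.log (1 + A) := by positivity
  have hcg : c ≤ g * (1 + A) ^ p := by
    have := mul_le_mul_of_nonneg_right hg (Real.rpow_nonneg h1A.le p)
    rwa [mul_assoc, ← Real.rpow_add h1A, neg_add_cancel, Real.rpow_zero, mul_one] at this
  have : -(-q * Real.log (1 + A)) / g ≤ q * Real.log (1 + A) * (1 + A) ^ p / c := by
    rw [neg_mul, neg_neg, div_le_div_iff₀ hgpos hc]
    calc q * Real.log (1 + A) * c ≤ q * Real.log (1 + A) * (g * (1 + A) ^ p) :=
          mul_le_mul_of_nonneg_left hcg hnum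
      _ = q * Real.log (1 + A) * (1 + A) ^ p * g := by ring
  calc 12 * (-(-q * Real.log (1 + A)) / g)
      ≤ 12 * (q * Real.log (1 + A) * (1 + A) ^ p / c) := by gcongr
    _ = 12 * q * Real.log (1 + A) * (1 + A) ^ p / c := by ring

/-- **EXPONENTIAL profile ⇒ DOUBLE-exponential tower**: with `γ = exp(-C(1+A)^θ)` and any smallness
target `ε ≤ e⁻¹`, `log log E ≥ C(1+A)^θ` (OP22's `exp exp A^{O(1)}`). -/
theorem loglog_towerBound_of_exp {C θ A ε : ℝ} (hε : 0 < ε) (hε1 : ε ≤ Real.exp (-1)) :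
    C * (1 + A) ^ θ ≤ Real.log (Real.log (towerBound (Real.exp (-(C * (1 + A) ^ θ))) ε)) := by
  rw [log_towerBound hε]
  set g := Real.exp (-(C * (1 + A) ^ θ)) with hg
  have hgpos : 0 < g := Real.exp_pos _
  have hlogε : 1 ≤ Real.log ε⁻¹ := by
    rw [Real.log_inv]
    have := Real.log_le_log hε hε1
    rw [Real.log_exp] at this
    linarith
  have hge : Real.exp (C * (1 + A) ^ θ) ≤ 12 * (Real.log ε⁻¹ / g) := by
    have hinv : Real.exp (C * (1 + A) ^ θ) = 1 / g := by
      rw [hg, Real.exp_neg]; field_simp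
    rw [hinv, div_le_iff₀ hgpos]
    have : 12 * (Real.log ε⁻¹ / g) * g = 12 * Real.log ε⁻¹ := by field_simp
    rw [this]; linarith
  calc C * (1 + A) ^ θ = Real.log (Real.exp (C * (1 + A) ^ θ)) := (Real.log_exp _).symm
    _ ≤ Real.log (12 * (Real.log ε⁻¹ / g)) := Real.log_le_log (Real.exp_pos _) hge

/-- **RATE DICTIONARY, single exponential**: a bound `F(A) = exp(K A^p)` that must exceed `M ≥ 1`
(OP22 Cor. 1.2 mechanism: `‖∇u(t)‖_∞ ≳ (T-t)⁻¹` at blow-up vs `≤ t⁻¹ F(A)`) forces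
`A ≥ (log M / K)^{1/p}` — the `(log (T-t)⁻¹)^{1/p}` weak-`L³` rate. -/
theorem rate_of_singleExp {K a M : ℝ} {p : ℕ} (hK : 0 < K) (hp : 0 < p) (ha : 0 ≤ a)
    (hM : 1 ≤ M) (h : M ≤ Real.exp (K * a ^ p)) :
    (Real.log M / K) ^ (1 / (p : ℝ)) ≤ a := by
  have hlog : Real.log M ≤ K * a ^ p := by
    have := Real.log_le_log (by linarith) h
    rwa [Real.log_exp] at this
  have h1 : Real.log M / K ≤ a ^ p := by
    rw [div_le_iff₀ hK]; linarith
  have h0 : 0 ≤ Real.log M / K := div_nonneg (Real.log_nonneg hM) hK.le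
  calc (Real.log M / K) ^ (1 / (p : ℝ)) ≤ (a ^ p) ^ (1 / (p : ℝ)) :=
        Real.rpow_le_rpow h0 h1 (by positivity)
    _ = a := by
        rw [← Real.rpow_natCast, ← Real.rpow_mul ha, mul_one_div_cancel (by exact_mod_cast hp.ne'),
          Real.rpow_one]

/-- **RATE DICTIONARY, double exponential** (print: OP22 Cor. 1.2): `exp exp(K A^p) ≥ M ≥ e`
forces only `A ≥ (log log M / K)^{1/p}`. -/
theorem rate_of_doubleExp {K a M : ℝ} {p : ℕ} (hK : 0 < K) (hp : 0 < p) (ha : 0 ≤ a)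
    (hM : Real.exp 1 ≤ M) (h : M ≤ Real.exp (Real.exp (K * a ^ p))) :
    (Real.log (Real.log M) / K) ^ (1 / (p : ℝ)) ≤ a := by
  have hMpos : 0 < M := lt_of_lt_of_le (Real.exp_pos 1) hM
  have hlogM : 1 ≤ Real.log M := by
    have := Real.log_le_log (Real.exp_pos 1) hM
    rwa [Real.log_exp] at this
  have h' : Real.log M ≤ Real.exp (K * a ^ p) := by
    have := Real.log_le_log hMpos h
    rwa [Real.log_exp] at this
  exact rate_of_singleExp hK hp ha hlogM h'

/-! ## 4. The global currency: single-exponential Theorem 1.1 and the logarithmic rate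

The tree facts `ozanskiPalasek2022_axisym_weakL3_quantitative` (Thm 1.1, `exp exp(A^C)`) and
`ozanskiPalasek2022_axisym_weakL3_blowup_rate` (Cor 1.2, `(log log)^c`) with ONE exponential /
ONE logarithm removed.  These are the purpose-literal "threshold" statements; by §§1–2 (OP22 §7
run with `γ = A^{-p}`) `PolyHolderLaw p` should give the first, and the first gives the second by
the printed one-line argument (`‖u(t)‖_∞ ≥ c(T₀-t)^{-1/2}`); neither implication is kernel-checked
here (they are OP22 §§5–7 with one constant changed, resp. OP22 §1.3).  What IS checked: each is at
least as strong as the printed fact (`toPrinted`). -/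

/-- **SINGLE-EXPONENTIAL OŻAŃSKI–PALASEK** (typed target, OPEN): Thm 1.1 verbatim (tree rendering)
with `palasekDoubleExp C A = exp exp(A^C)` replaced by `exp(A^C)`. -/
@[conjecture] def OzanskiPalasekSingleExp : Prop :=
  ∃ C A₀ : ℝ, 0 < C ∧ ∀ (T A : ℝ) (u : ℝ → (EuclideanSpace ℝ (Fin 3)) → (EuclideanSpace ℝ (Fin 3))) (p : ℝ → (EuclideanSpace ℝ (Fin 3)) → ℝ),
      IsHkClassicalSolutionOn (Icc 0 T) u p →
      (∀ t ∈ Icc 0 T, IsAxisymmetric (u t)) →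
      (∀ t ∈ Icc 0 T, FunctionSpaces.eWeakLpPow (u t) 3 volume ≤ ENNReal.ofReal A ^ (3 : ℝ)) →
      A₀ ≤ A →
      ∀ t ∈ Ioc 0 T, ∀ x : (EuclideanSpace ℝ (Fin 3)),
        ‖u t x‖ ≤ Real.exp (A ^ C) * t ^ (-(1 / 2 : ℝ)) ∧
        ‖fderiv ℝ (u t) x‖ ≤ Real.exp (A ^ C) * t ^ (-(1 : ℝ))

/-- The single-exponential statement implies the printed double-exponential one (`x ≤ eˣ`). -/
theorem OzanskiPalasekSingleExp.toPrinted (h : OzanskiPalasekSingleExp) :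
    ozanskiPalasek2022_axisym_weakL3_quantitative := by
  obtain ⟨C, A₀, hC, h⟩ := h
  refine ⟨C, A₀, hC, fun T A u p hu hax h3 hA t ht x => ?_⟩
  obtain ⟨h0, h1⟩ := h T A u p hu hax h3 hA t ht x
  have hle : Real.exp (A ^ C) ≤ palasekDoubleExp C A := by
    unfold palasekDoubleExp
    exact Real.exp_le_exp.mpr (Real.add_one_le_exp _ |>.trans' (by linarith))
  have ht0 : 0 < t := ht.1
  constructor
  · exact h0.trans (mul_le_mul_of_nonneg_right hle (Real.rpow_nonneg ht0.le _))
  · exact h1.trans (mul_le_mul_of_nonneg_right hle (Real.rpow_nonneg ht0.le _))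

/-- **LOGARITHMIC weak-`L³` BLOW-UP RATE** (typed target, OPEN): Cor 1.2 verbatim (tree rendering)
with `log log (T₀-t)⁻¹` replaced by `log (T₀-t)⁻¹` — the class in which log-corrected Type-I
axisymmetric scenarios live. -/
@[conjecture] def WeakL3LogRate : Prop :=
  ∃ c : ℝ, 0 < c ∧ ∀ (T₀ : ℝ), 0 < T₀ →
    ∀ (u : ℝ → (EuclideanSpace ℝ (Fin 3)) → (EuclideanSpace ℝ (Fin 3))) (p : ℝ → (EuclideanSpace ℝ (Fin 3)) → ℝ),
      (∀ T' ∈ Ioo 0 T₀, IsHkClassicalSolutionOn (Icc 0 T') u p) →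
      (∀ t ∈ Ico 0 T₀, IsAxisymmetric (u t)) →
      (∀ B : ℝ, ∃ t ∈ Ico 0 T₀, ∃ x : (EuclideanSpace ℝ (Fin 3)), B < ‖u t x‖) →
      ∀ K : ℝ, ∃ᶠ t in 𝓝[<] T₀,
        ENNReal.ofReal (K * Real.log (T₀ - t)⁻¹ ^ c) ^ (3 : ℝ) <
          FunctionSpaces.eWeakLpPow (u t) 3 volume

/-- `log y ≤ y`, so a logarithmic rate implies the printed double-logarithmic one. -/
theorem WeakL3LogRate.toPrinted (h : WeakL3LogRate) :
    ozanskiPalasek2022_axisym_weakL3_blowup_rate := by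
  obtain ⟨c, hc, h⟩ := h
  refine ⟨c, hc, fun T₀ hT₀ u p hu hax hblow K => ?_⟩
  have hfreq := h T₀ hT₀ u p hu hax hblow K
  -- eventually (as t ↑ T₀) `1 ≤ log (T₀ - t)⁻¹`
  have hev : ∀ᶠ t in 𝓝[<] T₀, 1 ≤ Real.log (T₀ - t)⁻¹ := by
    have h1 : ∀ᶠ t in 𝓝[<] T₀, t < T₀ := self_mem_nhdsWithin
    have h2 : ∀ᶠ t in 𝓝[<] T₀, T₀ - Real.exp (-1) < t := by
      apply eventually_nhdsWithin_of_eventually_nhds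
      exact lt_mem_nhds (by linarith [Real.exp_pos (-1)])
    filter_upwards [h1, h2] with t ht1 ht2
    have hpos : 0 < T₀ - t := by linarith
    have hle : T₀ - t ≤ Real.exp (-1) := by linarith
    rw [Real.log_inv, le_neg]
    have := Real.log_le_log hpos hle
    rwa [Real.log_exp] at this
  refine (hfreq.and_eventually hev).mono ?_
  rintro t ⟨hlt, h1⟩
  have hy0 : 0 < Real.log (T₀ - t)⁻¹ := by linarith
  have hloglt : Real.log (Real.log (T₀ - t)⁻¹) ≤ Real.log (T₀ - t)⁻¹ :=
    (Real.log_le_sub_one_of_pos hy0).trans (by linarith)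
  have hlogy : 0 ≤ Real.log (Real.log (T₀ - t)⁻¹) := Real.log_nonneg h1
  have hmono : ENNReal.ofReal (K * Real.log (Real.log (T₀ - t)⁻¹) ^ c) ≤
      ENNReal.ofReal (K * Real.log (T₀ - t)⁻¹ ^ c) := by
    by_cases hK : 0 ≤ K
    · apply ENNReal.ofReal_le_ofReal
      exact mul_le_mul_of_nonneg_left (Real.rpow_le_rpow hlogy hloglt hc.le) hK
    · push Not at hK
      have : K * Real.log (Real.log (T₀ - t)⁻¹) ^ c ≤ 0 :=
        mul_nonpos_of_nonpos_of_nonneg hK.le (Real.rpow_nonneg hlogy c)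
      rw [ENNReal.ofReal_of_nonpos this]
      exact bot_le
  exact lt_of_le_of_lt (ENNReal.rpow_le_rpow hmono (by norm_num)) hlt

end

end Summit.NavierStokesRegularity.NavierStokesRegularity.Theorems.SwirlHolderTower
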